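import Summits.ABC.IUTFork.Joshi.ArithmeticoidProperties
import Summits.ABC.IUTFork.Joshi.ArithmeticoidPeriods
import Mathlib.NumberTheory.NumberField.ProductFormula
import Mathlib.LinearAlgebra.Countable
import Mathlib.Analysis.Normed.Field.WithAbs
import HarnessLib

/-!
# An ARITHMETIC model of `ATS2h.DeformationDatum` ([J-2½] arXiv:2305.10398 §4–§5): every number field with ALL its
# places, the Artin–Whaples absolute values and Mathlib's product formula (block E, rung LADDER-ABC:A2.E, seat E-t48)

PROOF-SIDE companion (NV-MODEL row «arithmeticoids», E-plan-2 08:10:57Z (4)) of seat E-t37's object files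
`Joshi/Arithmeticoids.lean` (p430482) / `ArithmeticoidProperties.lean` (p430871) / `ArithmeticoidPeriods.lean` (p430897), which
type K. Joshi, *Construction of Arithmetic Teichmüller Spaces II½*, arXiv:2305.10398 (unrefereed; bib `Joshi2023ATS2half`)
§4–§5 over the 28-field HYPOTHESIS structure `DeformationDatum L V Lv Y K G A`. E-t37's `Joshi/ArithmeticoidsToyModel.lean`
(p432522) certifies joint satisfiability by a ONE-PLACE TOY whose absolute value is TRIVIAL on `L = ℚ` («no mathematical content
about number fields»). THIS FILE gives the arithmetic-grade model, for EVERY number field `L` (Mathlib `NumberField L`):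
* `V := InfinitePlace L ⊕ FinitePlace L` (ALL places), `V^arc :=` the infinite places; `Countable V` PROVED (`𝓞 L` is a countable
  Noetherian ring ⇒ countably many ideals; `FinitePlace L ≃ HeightOneSpectrum (𝓞 L)`);
* `L_v := (L, |−|_v)` = Mathlib `WithAbs v` (the signature reads `L_v` only through `toLv`/`absLv`/`emb`; completing adds nothing it
  can see), `|−|_v :=` the ARTIN–WHAPLES normalisation `w(x)^{mult w}` at an infinite place (at a complex place NOT an absolute
  value but a Bourbaki valued field with constant `2^{mult}` — why E-t37 typed `IsValuedField` with a constant, §2.3), `w(x)` at a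
  finite place; `p_v :=` residue characteristic (least prime factor of `N𝔭_v`), `1` at infinite `v`; `ord_v : L* → ℤ` the
  normalised valuation (uniformisers ↦ `+1`), trivial at infinite `v`;
* the PRODUCT FORMULA field `sum_log_absLv : Σ_v log|x|_v = 0` DISCHARGED from Mathlib `NumberField.prod_abs_eq_one` (genuine: all
  places, non-trivial on `L`), `finite_absLv_ne_one` from `FinitePlace.hasFiniteMulSupport`;
* geometry HONEST-DEGENERATE but not trivial: `Y_v := ℤ` = ONE Frobenius orbit of closed points, `ϕ_v := (n ↦ n+1)` at finite `v`,
  `ϕ_v = 1` at infinite `v`; `act_v(x) := ϕ_v^{ord_v x}` (so Thm. 4.2.3 (4) holds BY CONSTRUCTION); `G_v = A_v = Unit`; residue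
  fields `K_{y_n} := L_v` with `|−|_{K_{y_n}} := |−|_v^{p_v^n}`, `α_v(y_n) := p_v^{−n}` (the valuation rescales along the Frobenius
  orbit — a cartoon of (5.3.7) «`α_{y′} ≠ α_y` in general», nothing more); uninterpreted predicates `False`, `base := cp`.
* VERDICTS at the model: `LActsByFrobeniusPowers` HOLDS; **`PeriodMapNonconstant` HOLDS** (`model_periodMapNonconstant`; at the toy
  it FAILS ⇒ Thm. 5.10.1 (7) as typed is INDEPENDENT of the signature); `Thm552_7` FAILS (`not_model_thm552_7`: with `y`-independent
  fibres `K v y` all arithmetic rings are the same topological ring).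
No side taken on [IUTchIII] Cor. 3.12 or on any author; typed ≠ proved; a model exhibits satisfiability, nothing more. The model is
[folklore] (Artin–Whaples 1945 / Mathlib); `[claim: Joshi2023ATS2half, status: disputed]` tags only the quoted claim-`Prop`s.
-/


noncomputable section

open NumberField TopologicalSpace

namespace Summit.ABC.IUTFork.Joshi.ATS2h

/-! ## 0. Bourbaki valued fields: powers -/

namespace IsValuedField

variable {K : Type} [Field K] {abs : K → ℝ}

/-- A positive real power of a Bourbaki valued-field structure is again one (constant `A ↦ A^c`) — [J-2½] §2.3's reason
for allowing a constant: `|−|²` on `ℂ` qualifies. [folklore] -/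
theorem rpow (h : IsValuedField abs) {c : ℝ} (hc : 0 < c) : IsValuedField (fun x => abs x ^ c) where
  nonneg x := Real.rpow_nonneg (h.nonneg x) c
  eq_zero_iff x := by rw [Real.rpow_eq_zero_iff_of_nonneg (h.nonneg x), h.eq_zero_iff]; exact and_iff_left hc.ne'
  map_mul x y := by simp only [h.map_mul, Real.mul_rpow (h.nonneg x) (h.nonneg y)]
  exists_const := by
    obtain ⟨A, hA, hxy⟩ := h.exists_const
    refine ⟨A ^ c, Real.rpow_pos_of_pos hA c, fun x y => ?_⟩
    calc abs (x + y) ^ c ≤ (A * max (abs x) (abs y)) ^ c := Real.rpow_le_rpow (h.nonneg _) (hxy x y) hc.le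
      _ = A ^ c * (max (abs x) (abs y)) ^ c :=
          Real.mul_rpow hA.le ((h.nonneg x).trans (le_max_left _ _))
      _ ≤ A ^ c * max (abs x ^ c) (abs y ^ c) := by
          gcongr
          rcases max_choice (abs x) (abs y) with hm | hm <;> rw [hm] <;> simp
  nontrivial := by
    obtain ⟨x, hx, h1⟩ := h.nontrivial
    refine ⟨x, hx, fun h2 => h1 ?_⟩
    have h3 : (abs x ^ c) ^ c⁻¹ = abs x := Real.rpow_rpow_inv (h.nonneg x) hc.ne'
    rw [← h3, h2, Real.one_rpow]

/-- The norm of a normed field raised to a positive natural power is a Bourbaki valued-field structure (constant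
`2^m`) as soon as the norm is non-trivial. [folklore] -/
theorem norm_pow {F : Type} [NormedField F] (m : ℕ) (hm : m ≠ 0) (hnt : ∃ x : F, x ≠ 0 ∧ ‖x‖ ≠ 1) :
    IsValuedField (fun x : F => ‖x‖ ^ m) where
  nonneg x := pow_nonneg (norm_nonneg x) m
  eq_zero_iff x := by rw [pow_eq_zero_iff hm, norm_eq_zero]
  map_mul x y := by rw [norm_mul, mul_pow]
  exists_const := by
    refine ⟨2 ^ m, by positivity, fun x y => ?_⟩
    have hM : ‖x + y‖ ≤ 2 * max ‖x‖ ‖y‖ :=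
      (norm_add_le x y).trans (by rw [two_mul]; exact add_le_add (le_max_left _ _) (le_max_right _ _))
    calc ‖x + y‖ ^ m ≤ (2 * max ‖x‖ ‖y‖) ^ m := pow_le_pow_left₀ (norm_nonneg _) hM m
      _ = 2 ^ m * (max ‖x‖ ‖y‖) ^ m := mul_pow _ _ _
      _ ≤ 2 ^ m * max (‖x‖ ^ m) (‖y‖ ^ m) := by
          gcongr
          rcases max_choice ‖x‖ ‖y‖ with h | h <;> rw [h] <;> simp
  nontrivial := by
    obtain ⟨x, hx, h1⟩ := hnt
    exact ⟨x, hx, fun h2 => h1 ((pow_eq_one_iff_of_nonneg (norm_nonneg x) hm).1 h2)⟩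

end IsValuedField

/-! ## 1. The places of a number field -/

namespace NumberFieldModel

variable (L : Type) [Field L] [NumberField L]

/-- `V_L :=` ALL places of the number field `L`: infinite (archimedean) and finite ([J-2½] §2.2 «the set of inequivalent
non-trivial valuations of `L`»; Mathlib `InfinitePlace` / `FinitePlace`). [folklore] -/
abbrev Place : Type := InfinitePlace L ⊕ FinitePlace L

/-- `V^arc_L ⊂ V_L`, the archimedean places. [folklore] -/
def arch : Set (Place L) := Set.range Sum.inl

/-- `inl w` is archimedean. [folklore] -/
@[simp] theorem inl_mem_arch (w : InfinitePlace L) : (Sum.inl w : Place L) ∈ arch L := ⟨w, rfl⟩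

/-- `inr w` is not archimedean. [folklore] -/
@[simp] theorem inr_notMem_arch (w : FinitePlace L) : (Sum.inr w : Place L) ∉ arch L := by
  rintro ⟨w', h⟩; cases h

/-- `V_L` is countable ([J-2½] proof of Lem. 4.1.2, p.20 l.74 «The set `V_L` is countable»): `𝓞 L` is countable (a finite
`ℤ`-module) and Noetherian, so `FinitePlace L ≃ HeightOneSpectrum (𝓞 L) ↪ Ideal (𝓞 L) ↞ Finset (𝓞 L)` is countable. (The tree's
`Cor312Prov.countable_finitePlace` proves the finite half; not imported here — R14 keeps `Cor312*` out of Joshi object/model files.)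
[folklore] -/
theorem countable_place : Countable (Place L) := by
  haveI : Countable (𝓞 L) := Finsupp.Countable.of_moduleFinite (R := ℤ)
  haveI : Countable (Ideal (𝓞 L)) :=
    Function.Surjective.countable (f := fun s : Finset (𝓞 L) => Ideal.span (s : Set (𝓞 L))) fun I =>
      IsNoetherian.noetherian I
  haveI : Countable (IsDedekindDomain.HeightOneSpectrum (𝓞 L)) :=
    Function.Injective.countable (f := fun v : IsDedekindDomain.HeightOneSpectrum (𝓞 L) => v.asIdeal)
      fun v w h => IsDedekindDomain.HeightOneSpectrum.ext h
  haveI : Countable (FinitePlace L) := Countable.of_equiv _ (FinitePlace.equivHeightOneSpectrum (K := L)).symm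
  infer_instance

/-- The absolute value underlying a place (Mathlib's representative: `|σ(−)|_ℂ` at an infinite place, `N𝔭^{−ord_𝔭}` at a finite
place). [folklore] -/
def absval : Place L → AbsoluteValue L ℝ := fun v => Sum.elim (fun w : InfinitePlace L => w.1) (fun w : FinitePlace L => w.1) v

/-- The residue characteristic `p_v` of a place: the least prime factor of `N(𝔭_v) = p^{f_v}` at a finite place, `1` at an
infinite place ([J-2½] §5 p.29 l.37; Cor. 5.6.2 «`p_v = 1` for `v ∈ V^arc`»). [folklore] -/
def resChar : Place L → ℕ
  | Sum.inl _ => 1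
  | Sum.inr w => (Ideal.absNorm w.maximalIdeal.asIdeal).minFac

/-- `p_v` is prime at a finite place (`N𝔭 > 1`). [folklore] -/
theorem resChar_prime (w : FinitePlace L) : (resChar L (Sum.inr w)).Prime :=
  Nat.minFac_prime (NumberField.HeightOneSpectrum.one_lt_absNorm w.maximalIdeal).ne'

/-- `0 < p_v` at every place. [folklore] -/
theorem resChar_pos (v : Place L) : 0 < resChar L v := by
  rcases v with w | w; exacts [Nat.one_pos, (resChar_prime L w).pos]

/-- The Artin–Whaples weight of a place: `mult w ∈ {1, 2}` at an infinite place, `1` at a finite place. [folklore] -/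
def weight : Place L → ℕ
  | Sum.inl w => w.mult
  | Sum.inr _ => 1

/-- The weight is non-zero. [folklore] -/
theorem weight_ne_zero (v : Place L) : weight L v ≠ 0 := by
  rcases v with w | w; exacts [InfinitePlace.mult_ne_zero, one_ne_zero]

/-! ## 2. `L_v = (L, |−|_v)` and the Artin–Whaples absolute values -/

/-- `L_v :=` the field `L` with the topology of the place `v` (Mathlib `WithAbs`). [folklore] -/
abbrev Loc (v : Place L) : Type := WithAbs (absval L v)

/-- `L ↪ L_v` (the identity on elements). [folklore] -/
def toLoc (v : Place L) : L →+* Loc L v := (WithAbs.equiv (absval L v)).symm.toRingHom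

/-- `‖toLoc v x‖ = |x|_v` (the place's representative absolute value). [folklore] -/
theorem norm_toLoc (v : Place L) (x : L) : ‖toLoc L v x‖ = absval L v x := rfl

/-- The ARTIN–WHAPLES absolute value `|−|_v := ‖−‖^{weight v}` on `L_v` ([J-2½] §5.3 p.32 l.9–12; at a complex place the SQUARE
of the usual absolute value). [folklore] -/
def absLoc (v : Place L) (x : Loc L v) : ℝ := ‖x‖ ^ weight L v

/-- `|x|_v > 0` for `x ≠ 0`. [folklore] -/
theorem absLoc_pos (v : Place L) {x : Loc L v} (hx : x ≠ 0) : 0 < absLoc L v x :=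
  pow_pos (norm_pos_iff.2 hx) _

/-- Every place carries an element of `L` of absolute value `≠ 1` (places are non-trivial absolute values). [folklore] -/
theorem exists_norm_toLoc_ne_one (v : Place L) : ∃ x : L, x ≠ 0 ∧ ‖toLoc L v x‖ ≠ 1 := by
  rcases v with w | w
  · obtain ⟨x, hx, h1⟩ := w.isNontrivial
    exact ⟨x, hx, h1⟩
  · obtain ⟨r, hr, hr0⟩ := Submodule.exists_mem_ne_zero_of_ne_bot w.maximalIdeal.ne_bot
    refine ⟨algebraMap (𝓞 L) L r, by simpa using hr0, ne_of_lt ?_⟩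
    rw [norm_toLoc]
    change w _ < 1
    rw [← FinitePlace.norm_embedding_eq w]
    exact (FinitePlace.norm_lt_one_iff_mem L w.maximalIdeal r).2 hr

/-- `(L_v, |−|_v)` is a Bourbaki valued field (constant `2^{weight}`; non-trivial). [folklore] -/
theorem absLoc_isValuedField (v : Place L) : IsValuedField (absLoc L v) := by
  obtain ⟨x, hx, h1⟩ := exists_norm_toLoc_ne_one L v
  exact IsValuedField.norm_pow (weight L v) (weight_ne_zero L v)
    ⟨toLoc L v x, by simpa [toLoc] using hx, h1⟩

/-- `|x|_v` on `L` in closed form: `w(x)^{mult w}` at an infinite place. [folklore] -/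
theorem absLoc_toLoc_inl (w : InfinitePlace L) (x : L) :
    absLoc L (Sum.inl w) (toLoc L (Sum.inl w) x) = w x ^ w.mult := rfl

/-- `|x|_v` on `L` in closed form: `w(x)` at a finite place. [folklore] -/
theorem absLoc_toLoc_inr (w : FinitePlace L) (x : L) :
    absLoc L (Sum.inr w) (toLoc L (Sum.inr w) x) = w x := by
  change ‖toLoc L (Sum.inr w) x‖ ^ 1 = w x
  rw [pow_one]
  rfl

/-- For `x ∈ L*`, `|x|_v ≠ 1` only at finitely many places (implicit in the product formula (5.3.1)). [folklore] -/
theorem finite_absLoc_ne_one (x : Lˣ) : {v : Place L | absLoc L v (toLoc L v x) ≠ 1}.Finite := by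
  have hx : (x : L) ≠ 0 := x.ne_zero
  have hfin : (Sum.inr '' {w : FinitePlace L | w (x : L) ≠ 1} ∪ Set.range Sum.inl : Set (Place L)).Finite :=
    ((FinitePlace.hasFiniteMulSupport hx).image _).union (Set.finite_range _)
  refine hfin.subset fun v hv => ?_
  rcases v with w | w
  · exact Or.inr ⟨w, rfl⟩
  · refine Or.inl ⟨w, ?_, rfl⟩
    simpa [absLoc_toLoc_inr] using hv

/-- **THE PRODUCT FORMULA (5.3.2)** `Σ_{v ∈ V_L} log|x|_v = 0` for `x ∈ L*`, DISCHARGED from Mathlib's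
`NumberField.prod_abs_eq_one` (`∏_{w ∣ ∞} w(x)^{mult w} · ∏_{w ∤ ∞} w(x) = 1`) — [Artin–Whaples 1945] as cited [J-2½] §5.3
p.32 l.9–21. [folklore] -/
theorem sum_log_absLoc (x : Lˣ) : ∑ᶠ v : Place L, Real.log (absLoc L v (toLoc L v x)) = 0 := by
  classical
  have hx : (x : L) ≠ 0 := x.ne_zero
  have hf := FinitePlace.hasFiniteMulSupport hx
  have hsupp : (Function.support fun v : Place L => Real.log (absLoc L v (toLoc L v x))) ⊆
      (((Finset.univ : Finset (InfinitePlace L)).disjSum hf.toFinset : Finset (Place L)) : Set (Place L)) := by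
    intro v hv
    rw [Function.mem_support] at hv
    rw [Finset.mem_coe]
    rcases v with w | w
    · exact Finset.inl_mem_disjSum.2 (Finset.mem_univ w)
    · refine Finset.inr_mem_disjSum.2 (hf.mem_toFinset.2 ?_)
      rw [Function.mem_mulSupport]
      intro h1
      apply hv
      rw [absLoc_toLoc_inr, h1, Real.log_one]
  rw [finsum_eq_sum_of_support_subset _ hsupp, Finset.sum_disjSum]
  have hinf : ∀ w ∈ (Finset.univ : Finset (InfinitePlace L)), (w (x : L)) ^ w.mult ≠ 0 :=
    fun w _ => pow_ne_zero _ (w.pos_iff.2 hx).ne'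
  have hfinp : ∀ w ∈ hf.toFinset, w (x : L) ≠ 0 := fun w _ => (FinitePlace.pos_iff.2 hx).ne'
  simp_rw [absLoc_toLoc_inl, absLoc_toLoc_inr]
  rw [← Real.log_prod hinf, ← Real.log_prod hfinp, ← Real.log_mul (Finset.prod_ne_zero_iff.2 hinf)
    (Finset.prod_ne_zero_iff.2 hfinp), ← finprod_eq_prod _ hf, NumberField.prod_abs_eq_one hx, Real.log_one]

/-! ## 3. `ord_v`, the Frobenius orbit `Y_v := ℤ`, and the model -/

/-- `ord_v : L* → ℤ`, the normalised discrete valuation at a finite place (uniformisers ↦ `+1`: Mathlib's multiplicative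
valuation `𝔭 ↦ ofAdd(−1)` inverted), trivial at an infinite place. [folklore] -/
def ord : (v : Place L) → Lˣ →* Multiplicative ℤ
  | Sum.inl _ => 1
  | Sum.inr w => invMonoidHom.comp
      ((WithZero.unitsWithZeroEquiv (α := Multiplicative ℤ)).toMonoidHom.comp
        (Units.map (w.maximalIdeal.valuation L).toMonoidHom))

/-- `ϕ_v` on the Frobenius orbit `Y_v := ℤ`: the shift `n ↦ n + 1` at a finite place, the identity at an infinite place
(§4.5 «one takes `ϕ_v = 1`»). [folklore] -/
def frob : Place L → ℤ ≃ₜ ℤ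
  | Sum.inl _ => Homeomorph.refl ℤ
  | Sum.inr _ => Homeomorph.addRight (1 : ℤ)

/-- `|−|_{K_{y_n}} := |−|_v^{p_v^n}` on the residue field `K_{y_n} := L_v` of the `n`-th point of the Frobenius orbit (the
valuation rescales by `p_v` along `ϕ_v`, as on the Fargues–Fontaine curve; constant at infinite places where `p_v = 1`). [folklore] -/
def absK (v : Place L) (n : ℤ) (x : Loc L v) : ℝ := absLoc L v x ^ ((resChar L v : ℝ) ^ n)

/-- The normalisation coordinate `α_v(y_n) := p_v^{−n}` ((5.3.3)/(5.3.5)). [folklore] -/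
def alpha (v : Place L) (n : ℤ) : ℝ := ((resChar L v : ℝ) ^ n)⁻¹

/-- `p_v^n > 0`. [folklore] -/
theorem resChar_zpow_pos (v : Place L) (n : ℤ) : 0 < (resChar L v : ℝ) ^ n :=
  zpow_pos (by exact_mod_cast resChar_pos L v) n

/-- **THE ARITHMETIC MODEL of `DeformationDatum`** for the number field `L`: all places, Artin–Whaples absolute values,
Mathlib's product formula; `Y_v := ℤ` one Frobenius orbit, `act_v(x) := ϕ_v^{ord_v x}`, trivial Galois / Lubin–Tate groups,
`K_{y_n} := L_v` with `|−|_v^{p_v^n}`, `α_v(y_n) = p_v^{−n}`; uninterpreted predicates `False`, `base := cp`. [folklore] -/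
def model : DeformationDatum L (Place L) (Loc L) (fun _ => ℤ) (fun v _ => Loc L v) (fun _ => Unit) (fun _ => Unit) where
  base := TiltBase.cp
  Varc := arch L
  countable_V := countable_place L
  p := resChar L
  p_prime := fun v hv => by
    rcases v with w | w
    · exact (hv (inl_mem_arch L w)).elim
    · exact resChar_prime L w
  p_arch := fun v hv => by
    rcases v with w | w
    · rfl
    · exact (inr_notMem_arch L w hv).elim
  toLv := toLoc L
  metrizable := fun _ => inferInstance
  pt0 := fun _ => 0
  frob := frob L
  frob_arch := fun v hv => by
    rcases v with w | w
    · rfl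
    · exact (inr_notMem_arch L w hv).elim
  gal := fun _ => 1
  ord := ord L
  ord_arch := fun v hv => by
    rcases v with w | w
    · rfl
    · exact (inr_notMem_arch L w hv).elim
  act := fun v => (zpowersHom (ℤ ≃ₜ ℤ) (frob L v)).comp (ord L v)
  lt := fun _ => 1
  absK := absK L
  absK_isValuedField := fun v n => (absLoc_isValuedField L v).rpow (resChar_zpow_pos L v n)
  emb := fun _ _ => RingHom.id _
  absLv := absLoc L
  absLv_isValuedField := absLoc_isValuedField L
  finite_absLv_ne_one := finite_absLoc_ne_one L
  sum_log_absLv := sum_log_absLoc L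
  α := alpha L
  α_pos := fun v n => inv_pos.2 (resChar_zpow_pos L v n)
  absLv_eq_rpow := fun v n x => by
    change absLoc L v x = (absLoc L v x ^ ((resChar L v : ℝ) ^ n)) ^ ((resChar L v : ℝ) ^ n)⁻¹
    exact (Real.rpow_rpow_inv ((absLoc_isValuedField L v).nonneg x) (resChar_zpow_pos L v n).ne').symm
  IsMaxComplete := fun _ _ => False
  ResidueFieldOfCompletion := fun _ _ => False
  ResidueFieldFpBar := fun _ _ => False
  valueGroupCompletion := fun v => Set.range fun x : (Loc L v)ˣ => absLoc L v x

/-- The signature `DeformationDatum` is inhabited by the arithmetic of ANY number field. [folklore] -/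
theorem model_nonempty :
    Nonempty (DeformationDatum L (Place L) (Loc L) (fun _ => ℤ) (fun v _ => Loc L v) (fun _ => Unit) (fun _ => Unit)) :=
  ⟨model L⟩

/-! ## 4. Verdicts of the arithmetic model on the claim-`Prop`s -/

/-- [J-2½] Thm. 4.2.3 (4) `LActsByFrobeniusPowers` («the `L*` action on each factor is through powers of the Frobenius»,
`x ↦ ϕ_v^{ord_v(x)}`) HOLDS at the model — by construction of `act`, contentfully (`ϕ_v` is the shift of `ℤ`).
[claim: Joshi2023ATS2half, status: disputed] -/
theorem model_lActsByFrobeniusPowers : (model L).LActsByFrobeniusPowers := by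
  intro v _ x
  rfl

/-- At the model the global Frobenius `L ↦ L^{(1)}` MOVES every arithmeticoid at every finite place (`y_v ↦ y_v + 1`):
Def. 5.9.1 is not the identity here (at the toy it is). [folklore] -/
theorem model_Lone_ne (y : (model L).Arith) (w : FinitePlace L) : (model L).Lone y (Sum.inr w) ≠ y (Sum.inr w) := by
  change y (Sum.inr w) + 1 ≠ y (Sum.inr w)
  exact (lt_add_one _).ne'

/-- [J-2½] Thm. 5.5.2 (7) `Thm552_7` («topologically inequivalent arithmeticoids exist») FAILS at the model: with residue
fields `K_{y} := L_v` independent of `y`, all arithmetic rings `∏_v K_{y_v}` are literally the same topological ring. (So, as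
typed over a `y`-independent fibre family, (7) is refutable; its content needs the fibres `K v y` to vary with `y`.)
[claim: Joshi2023ATS2half, status: disputed] -/
theorem not_model_thm552_7 : ¬ (model L).Thm552_7 := by
  rintro ⟨y₁, y₂, h⟩
  exact h ⟨RingEquiv.refl _, continuous_id, continuous_id⟩

/-- Two arithmeticoids of the model differing at a finite place have DIFFERENT product-formula hyperplanes `H_y`
((5.3.7) «`α_{y′} ≠ α_y` in general» realised: `α_v(y_n) = p_v^{−n}` is injective in `n`). [folklore] -/
theorem model_hyperplane_ne (w : FinitePlace L) (u : InfinitePlace L) (y₁ y₂ : (model L).Arith)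
    (h : y₁ (Sum.inr w) ≠ y₂ (Sum.inr w)) : (model L).hyperplane y₁ ≠ (model L).hyperplane y₂ := by
  classical
  -- the test vector `z := e_w − α_w(y₁ w) · e_u`
  set a₁ : ℝ := (model L).α (Sum.inr w) (y₁ (Sum.inr w)) with ha₁
  set z : Place L →₀ ℝ := Finsupp.single (Sum.inr w) 1 + Finsupp.single (Sum.inl u) (-a₁) with hz
  have hne : (Sum.inr w : Place L) ≠ Sum.inl u := Sum.inr_ne_inl
  have hαu : ∀ y : (model L).Arith, (model L).α (Sum.inl u) (y (Sum.inl u)) = 1 := fun y => by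
    change ((resChar L (Sum.inl u) : ℝ) ^ (y (Sum.inl u)))⁻¹ = 1
    simp [resChar]
  have hsum : ∀ y : (model L).Arith,
      (z.sum fun v r => (model L).α v (y v) * r) = (model L).α (Sum.inr w) (y (Sum.inr w)) - a₁ := by
    intro y
    rw [hz, Finsupp.sum_add_index' (fun _ => mul_zero _) (fun _ _ _ => mul_add _ _ _),
      Finsupp.sum_single_index (mul_zero _), Finsupp.sum_single_index (mul_zero _), hαu, mul_one, one_mul]
    ring
  have h1 : z ∈ (model L).hyperplane y₁ := by
    change (z.sum fun v r => (model L).α v (y₁ v) * r) = 0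
    rw [hsum, ha₁, sub_self]
  have h2 : z ∉ (model L).hyperplane y₂ := by
    change ¬ (z.sum fun v r => (model L).α v (y₂ v) * r) = 0
    rw [hsum, sub_eq_zero, ha₁]
    change ¬ ((resChar L (Sum.inr w) : ℝ) ^ (y₂ (Sum.inr w)))⁻¹ = ((resChar L (Sum.inr w) : ℝ) ^ (y₁ (Sum.inr w)))⁻¹
    rw [inv_inj]
    have hp : (1 : ℝ) < resChar L (Sum.inr w) := by exact_mod_cast (resChar_prime L w).one_lt
    exact fun heq => h (zpow_right_injective₀ (zero_lt_one.trans hp) hp.ne' heq).symm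
  intro heq
  exact h2 (heq ▸ h1)

/-- **[J-2½] Thm. 5.10.1 (7) `PeriodMapNonconstant` HOLDS at the arithmetic model** (it FAILS at the one-point toy p432522): the
period map `y ↦ H_y` separates `y⁰` from its Frobenius translate at any finite place. Hence (7), as typed, is INDEPENDENT of the
signature — contentful. (`L` has a finite place: `𝓞 L` has a maximal ideal; and an infinite place.) [claim: Joshi2023ATS2half, status: disputed] -/
theorem model_periodMapNonconstant : (model L).PeriodMapNonconstant := by
  classical
  obtain ⟨u⟩ : Nonempty (InfinitePlace L) := inferInstance
  obtain ⟨𝔭, h𝔭⟩ := Ideal.exists_maximal (𝓞 L)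
  have hbot : 𝔭 ≠ ⊥ := Ring.ne_bot_of_isMaximal_of_not_isField h𝔭 (RingOfIntegers.not_isField L)
  let w : FinitePlace L := FinitePlace.mk ⟨𝔭, h𝔭.isPrime, hbot⟩
  refine ⟨(model L).pt0, (model L).Lone (model L).pt0, ?_⟩
  exact model_hyperplane_ne L w u _ _ (model_Lone_ne L _ w).symm

end NumberFieldModel

end Summit.ABC.IUTFork.Joshi.ATS2h

end
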